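import Literature.NumberTheory.GelbartRogawski1991.LocalDoubledSiegelParabolicModularCharacter
import Literature.NumberTheory.GelbartRogawski1991.CMSplittingCharLocalMu
import Literature.NumberTheory.Automorphic.LocalRingUnitModulusProduct
import HarnessLib

/-!
# The twist character of the soft road: `μ_v(det p) = μ_v(det_Δ p)²` on the Siegel parabolic of the doubled rank-one unitary group,
# and the scalar identity `μ_v(det p)⁻¹ · χ_v(det_Δ^{(2)}) · ∏_w ‖det_Δ^{(2)}_w‖^{1∕2} = Δ_{P_Δ}(p)` under `det_Δ^{(2)} = (det_Δ^{(1)})²`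

[Kudla1994] S. S. Kudla, Israel J. Math. 87 (1994), §3 Thm. 3.1 (the character `χ(x(p)) |x(p)|^{s}` of the Siegel parabolic in the splitting);
[HarrisKudlaSweet1996] §1 (1.5), (1.15)–(1.16); [Liu2021] Y. Liu, Camb. J. Math. 9 (2021), App. D §D.1 Step 2 (the local character `μ_v`, kernel of
`μ_v|_{F^×}` = norms); [Rogawski1990] §1.10 p. 9 (Borel of `U(1,1)`: `d(α, ᾱ⁻¹)`).  Topic `NumberTheory/GelbartRogawski1991`; namespace
`Literature.NumberTheory.GelbartRogawski1991.UnitaryDualPair.LocalSplitting`.  THEOREMS ONLY (no definition, no instance, no notation, no named fact,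
no `sorry`).  CM tokens: `L ⊃ L⁺` a CM field, `c̄ = IsCMField.complexConj L`, `v` a finite place of `L⁺`, `E_v = LocalRing L v = ∏_{w ∣ v} L_w`,
`σ = conjLocal L c̄ v = c̄ ⊗ 1`, `χ` a Hecke character of `L` with `IsSplittingChar L 1 χ` (`χ|_{𝕀_{L⁺}} = ε_{L∕L⁺}`), `μ_v = ` ★ `localMu L χ v : E_vˣ →* ℂˣ`
(`x ↦ ∏_w χ_w(x_w)`).

* §1 **`localMu_mul_conjLocal_eq_one`**: `μ_v(z · σ z) = 1` for EVERY `z ∈ E_vˣ` (split and non-split `v` at once): `z σz = ι_v(p² − δ²q²)` in the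
  coordinates `E_v = L⁺_v ⊕ L⁺_v δ` (★ `quadraticLocalEquiv_mul_conjLocal`) and `μ_v(ι_v a) = 1` on local norms (★ `localMu_toLocalRing_eq_one_iff`,
  [Liu2021, §D.1 Step 2] «the kernel of `μ|_{F^×}` is exactly `Nm E^×`»); hence `μ_v(σ z) = μ_v(z)⁻¹`.
* §2 **`chiDet_localComponent_inv_eq`**: the dictionary between the doubled datum's ★ `chiDet … (fun w ↦ (χ.localComponent w)⁻¹) h` and `μ_v`:
  `= (μ_v u)⁻¹` for any unit `u` of `E_v` with components `det_Δ h_w` (every rank `n`).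
* §3 **`det_matS_eq_mul_conjLocal_inv`** / **`localMu_det_eq_localMu_sq`**: for `p` in the Siegel parabolic `P_Δ` of the doubled rank-one group
  `H(L⁺_v) = U(T₀ ⊕ −T₀)(L⁺_v)` (★ `localPi L c̄ (1+1) J^𝔻 v`, ★ `IsSiegelDelta`), `det p = a · (σ a)⁻¹` with `a = (det_Δ p_w)_w` — the «SIEGEL = BOREL»
  transport ★ `exists_siegel_continuousMulEquiv_cmBorel` (`Φ p = [[M₀₀+M₀₁, ·], [0, M₁₁−M₀₁]]`, `(Φ p)₀₀ = a`) and the torus relation `σ(d₀) d₁ = 1` of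
  `U(Φ₂)` (★ `torus_relations_two`) — hence **`μ_v(det p) = μ_v(a)²`**.
* §4 **`twistScalar_eq_modularCharacter`** — THE SCALAR IDENTITY the soft road's twisted section needs: for ANY element `q` of a rank-two doubled group
  `U(T ⊕ −T)(L⁺_v)` with `det_Δ^{(2)} q_w = (det_Δ^{(1)} p_w)²` (the Kronecker image `ι p`, ★-to-be `detDelta_kronLoc`), the eigen-scalar of the
  parabolic `Δ`-functional (★ `apply_zero_toRep_mul_localSplitting_eq_mul`: `χ_v(det_Δ^{(2)} q) · ∏_w ‖det_Δ^{(2)} q_w‖^{1∕2}`) times the twist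
  `μ_v(det p)⁻¹` IS the modulus: **`μ_v(det p)⁻¹ · (chiDet χ⁻¹ q)⁻¹ · ∏_w √‖det_Δ^{(2)} q_w‖ = Δ_{P_Δ}(p)`** (★ ED. 2
  `modularCharacter_siegelDelta_eq_unitModulusChar`, ★ `coe_halfModulusChar_localRing_eq_prod`).

Cell hodgecm-mathlib, half A line LD2 (socket `stub_S1b_facts`, organ `LineThetaTypesComplementary₁`, soft road (π3)), plate (TW) FILE A of LD2-plan (g3)
DEALS #12 (4); `--supports stmt-HodgeConjecture-24832`.  HONEST LABEL: HC_CM is proved only modulo the 7 printed citations (2 remaining: hLiu418 =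
stmt-HodgeConjecture-24832, h413 = stmt-HodgeConjecture-24833) until rung 0 closes; this file discharges no named fact (count-neutral).

## References
* [Kudla1994] S. S. Kudla, *Splitting metaplectic covers of dual reductive pairs*, Israel J. Math. 87 (1994) 361–401, §3 Thm. 3.1.
* [HarrisKudlaSweet1996] M. Harris, S. S. Kudla, W. J. Sweet, J. Amer. Math. Soc. 9 (1996) 941–1004, §1 (1.5), (1.15)–(1.16).
* [Liu2021] Y. Liu, *Fourier–Jacobi cycles and arithmetic relative trace formula*, Camb. J. Math. 9 (2021), Def. 4.11, App. D §D.1 Step 2.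
* [Rogawski1990] J. D. Rogawski, Ann. of Math. Stud. 123 (1990), §1.10 p. 9, §12.1 p. 171.
-/

set_option autoImplicit false

noncomputable section

open NumberField IsDedekindDomain MeasureTheory MeasureTheory.Measure Matrix
open scoped NNReal MatrixGroups
open Literature.NumberTheory.Automorphic Literature.NumberTheory.Automorphic.UnitaryGroup
open Literature.NumberTheory.GaloisRepresentations Literature.RepresentationTheory.HarrisKudlaSweet1996

namespace Literature.NumberTheory.GelbartRogawski1991.UnitaryDualPair.LocalSplitting

variable (L : Type) [Field L] [NumberField L] [IsCMField L] (χ : HeckeCharacter L)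
  (v : HeightOneSpectrum (𝓞 ↥(maximalRealSubfield L)))

/-! ## §1 `μ_v(z · σ z) = 1` for every `z ∈ E_vˣ` -/

/-- **`μ_v(z · z^c) = 1` for every unit `z` of `E_v = ∏_{w ∣ v} L_w`** when `χ|_{𝕀_{L⁺}} = ε_{L∕L⁺}`: `z z^c = ι_v(p² − δ² q²)` is the image of a local
NORM (★ `quadraticLocalEquiv_mul_conjLocal`), on which `μ_v ∘ ι_v = ε_v` is trivial (★ `localMu_toLocalRing_eq_one_iff`).  Both split and non-split `v`.
[cite: Liu2021, App. D §D.1 Step 2] [cite: HarrisKudlaSweet1996, §1 (1.5)] -/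
theorem localMu_mul_conjLocal_eq_one (hχ : IsSplittingChar L 1 χ) (z : (LocalRing L v)ˣ) :
    localMu L χ v (z * Units.map (conjLocal L (IsCMField.complexConj L) v : LocalRing L v →* LocalRing L v) z) = 1 := by
  -- `z = ι_v p + ι_v q · δ`
  obtain ⟨pq, hpq⟩ : ∃ pq : v.adicCompletion ↥(maximalRealSubfield L) × v.adicCompletion ↥(maximalRealSubfield L),
      quadraticLocalEquiv L v (IsCMField.complexConj L) (complexConj_imagUnit L) (imagUnit_ne_zero L) pq = (z : LocalRing L v) :=
    ⟨(quadraticLocalEquiv L v (IsCMField.complexConj L) (complexConj_imagUnit L) (imagUnit_ne_zero L)).symm z,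
      ContinuousLinearEquiv.apply_symm_apply _ _⟩
  obtain ⟨p, q⟩ := pq
  have hz := quadraticLocalEquiv_mul_conjLocal L v p q
  rw [hpq] at hz
  -- `a := p² − δ² q²` is non-zero, since `z z^c` is a unit
  have key : ∀ a : v.adicCompletion ↥(maximalRealSubfield L),
      (z : LocalRing L v) * conjLocal L (IsCMField.complexConj L) v z = toLocalRing L v a →
        localMu L χ v (z * Units.map (conjLocal L (IsCMField.complexConj L) v : LocalRing L v →* LocalRing L v) z) = 1 := by
    intro a hza
    have ha0 : a ≠ 0 := by
      intro h0
      rw [h0, map_zero] at hza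
      exact (z * Units.map (conjLocal L (IsCMField.complexConj L) v : LocalRing L v →* LocalRing L v) z).ne_zero
        (by rw [Units.val_mul, Units.coe_map, MonoidHom.coe_coe]; exact hza)
    have h1 := (localMu_toLocalRing_eq_one_iff L χ v hχ (Units.mk0 a ha0)).2 ⟨z, hza⟩
    have hu : z * Units.map (conjLocal L (IsCMField.complexConj L) v : LocalRing L v →* LocalRing L v) z =
        Units.map (algebraMap (v.adicCompletion ↥(maximalRealSubfield L)) (LocalRing L v)).toMonoidHom (Units.mk0 a ha0) :=
      Units.ext (by rw [Units.val_mul, Units.coe_map, MonoidHom.coe_coe, hza]; rfl)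
    rw [hu]
    exact h1
  exact key _ hz

/-- **`μ_v(σ z) = μ_v(z)⁻¹`** for every unit `z` of `E_v` (§1). [cite: Liu2021, App. D §D.1 Step 2] [cite: HarrisKudlaSweet1996, §1 (1.5)] -/
theorem localMu_conjLocal_eq_inv (hχ : IsSplittingChar L 1 χ) (z : (LocalRing L v)ˣ) :
    localMu L χ v (Units.map (conjLocal L (IsCMField.complexConj L) v : LocalRing L v →* LocalRing L v) z) = (localMu L χ v z)⁻¹ := by
  have h := localMu_mul_conjLocal_eq_one L χ v hχ z
  rw [map_mul] at h
  exact eq_inv_of_mul_eq_one_right h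

/-! ## §2 The dictionary `chiDet … (χ_w⁻¹) h = μ_v(det_Δ h)⁻¹` -/

/-- **`∏_w χ_w⁻¹(det_Δ h_w) = μ_v(u)⁻¹`** for any unit `u` of `E_v` with components `det_Δ h_w` (★ `chiDet` at the family `χ_w⁻¹` of the doubled CM datum
versus ★ `localMu`; every rank `n`). [cite: HarrisKudlaSweet1996, §1 (1.15)] [cite: Liu2021, Def. 4.11] -/
theorem chiDet_localComponent_inv_eq {n : ℕ} {JD : Matrix (Fin (n + n)) (Fin (n + n)) L}
    (h : UnitaryGroup.localPi L (IsCMField.complexConj L) (n + n) JD v) (u : (LocalRing L v)ˣ)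
    (hu : ∀ w : PlacesOver L v, (u : LocalRing L v) w =
      detDelta (↥(maximalRealSubfield L)) L (IsCMField.complexConj L) v n w h) :
    chiDet (↥(maximalRealSubfield L)) L (IsCMField.complexConj L) v n (fun w => (χ.localComponent w.1)⁻¹) h = (localMu L χ v u)⁻¹ := by
  have hunit : ∀ w : PlacesOver L v, IsUnit (detDelta (↥(maximalRealSubfield L)) L (IsCMField.complexConj L) v n w h) := fun w => by
    rw [← hu w]
    exact (Units.map (Pi.evalMonoidHom (fun w : PlacesOver L v => w.1.adicCompletion L) w) u).isUnit
  have hunit' : ∀ w : PlacesOver L v, (hunit w).unit = Units.map (Pi.evalMonoidHom (fun w : PlacesOver L v => w.1.adicCompletion L) w) u :=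
    fun w => Units.ext (by rw [IsUnit.unit_spec, ← hu w]; rfl)
  unfold chiDet localMu
  rw [MonoidHom.finsetProd_apply, ← Finset.prod_inv_distrib]
  refine Finset.prod_congr rfl fun w _ => ?_
  rw [dif_pos (hunit w), hunit' w, MonoidHom.inv_apply, MonoidHom.comp_apply]

/-! ## §3 `det p = a · (σ a)⁻¹` and `μ_v(det p) = μ_v(a)²` on the Siegel parabolic of the doubled rank-one group -/

section Siegel

set_option synthInstance.maxHeartbeats 400000 in -- the CM Borel telescope (as ★ `CMBorelTorusConjHaar`)
set_option maxHeartbeats 1600000 in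
/-- **`det p = a · (σ a)⁻¹` for `p ∈ P_Δ(L⁺_v)`**, `a = (det_Δ p_w)_w` (`u` any unit with these components), `det p` read on the matrix of `p` over
`E_v` (★ `matS`): the Cayley transport `Φ p = [[M₀₀ + M₀₁, ·], [0, M₁₁ − M₀₁]] ∈ B₂` (★ `exists_siegel_continuousMulEquiv_cmBorel`) has `(Φ p)₀₀ = a`,
the Siegel condition `M₀₀ + M₀₁ = M₁₀ + M₁₁` (★ `isSiegelDelta_one_iff`) gives `det M = (Φ p)₀₀ (Φ p)₁₁`, and in `U(Φ₂)` the diagonal of a Borel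
element satisfies `σ(b₀₀) b₁₁ = 1` (★ `torus_relations_two` on `proj b`, ★ `coe_torusEntry_proj_borelTriple`) — `d(α, ᾱ⁻¹)`.
[cite: Rogawski1990, §1.10 p. 9] [cite: Kudla1994, §3 Thm. 3.1] -/
theorem det_matS_eq_mul_conjLocal_inv
    {T₀ : Matrix (Fin 1) (Fin 1) ↥(maximalRealSubfield L)} (hT₀ : T₀.IsSymm) (hT₀d : IsUnit T₀.det)
    {JD : Matrix (Fin (1 + 1)) (Fin (1 + 1)) L}
    (hJD : JD = (gramD (↥(maximalRealSubfield L)) 1 T₀).map (algebraMap (↥(maximalRealSubfield L)) L))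
    (P : Subgroup (UnitaryGroup.localPi L (IsCMField.complexConj L) (1 + 1) JD v))
    (hP : ∀ h, h ∈ P ↔ IsSiegelDelta (↥(maximalRealSubfield L)) L (IsCMField.complexConj L) (complexConj_imagUnit L)
      (imagUnit_ne_zero L) (imagUnit_mul_self L) v 1 hT₀ hJD h)
    (p : ↥P) (u : (LocalRing L v)ˣ)
    (hu : ∀ w : PlacesOver L v, (u : LocalRing L v) w =
      detDelta (↥(maximalRealSubfield L)) L (IsCMField.complexConj L) v 1 w (p : UnitaryGroup.localPi L (IsCMField.complexConj L) (1 + 1) JD v)) :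
    (matS (↥(maximalRealSubfield L)) L (IsCMField.complexConj L) v 1 (p : UnitaryGroup.localPi L (IsCMField.complexConj L) (1 + 1) JD v)).det =
      (u : LocalRing L v) * ((Units.map (conjLocal L (IsCMField.complexConj L) v : LocalRing L v →* LocalRing L v) u)⁻¹ : (LocalRing L v)ˣ) := by
  obtain ⟨Φ, hmat, hdet⟩ := exists_siegel_continuousMulEquiv_cmBorel L v hT₀ hT₀d hJD P hP
  set M := matS (↥(maximalRealSubfield L)) L (IsCMField.complexConj L) v 1 (p : UnitaryGroup.localPi L (IsCMField.complexConj L) (1 + 1) JD v)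
    with hM
  -- the Siegel condition
  have hS : M 0 0 + M 0 1 = M 1 0 + M 1 1 :=
    (isSiegelDelta_one_iff (↥(maximalRealSubfield L)) L (IsCMField.complexConj L) (complexConj_imagUnit L) (imagUnit_ne_zero L)
      (imagUnit_mul_self L) v hT₀ hJD (p : UnitaryGroup.localPi L (IsCMField.complexConj L) (1 + 1) JD v)).1 ((hP _).1 p.2)
  -- the diagonal of `b = Φ p` and the torus relation
  set b : ↥(cmBorelTriple L 2 v).P := Φ p with hb
  obtain ⟨d, hd⟩ := (mem_torusU_iff _).1 ((cmBorelTriple L 2 v).proj b).2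
  have hrel := (LineRing.torus_relations_two (conjLocal L (IsCMField.complexConj L) v) (cmLocalForm_eq_over L 2 v)
    ((cmBorelTriple L 2 v).proj b) hd).2
  have hdiag : ∀ i : Fin 2, (d i : LocalRing L v) =
      (((b : ↥(unitaryGroupOfForm (conjLocal L (IsCMField.complexConj L) v) (cmLocalForm L 2 v))) : GL (Fin 2) (LocalRing L v))).val i i := by
    intro i
    rw [← torusEntry_eq_of_glDiagonal_eq _ _ i ((cmBorelTriple L 2 v).proj b) d hd, coe_torusEntry_proj_borelTriple]
  have h00 : (((b : ↥(unitaryGroupOfForm (conjLocal L (IsCMField.complexConj L) v) (cmLocalForm L 2 v))) : GL (Fin 2) (LocalRing L v))).val 0 0 =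
      M 0 0 + M 0 1 := by
    rw [hb, hmat p]; rfl
  have h11 : (((b : ↥(unitaryGroupOfForm (conjLocal L (IsCMField.complexConj L) v) (cmLocalForm L 2 v))) : GL (Fin 2) (LocalRing L v))).val 1 1 =
      M 1 1 - M 0 1 := by
    rw [hb, hmat p]; rfl
  -- `u = d 0`
  have hu0 : u = d 0 := Units.ext (funext fun w => by rw [hu w, hdiag 0, hb, hdet p w])
  -- `d 1 = (σ (d 0))⁻¹`
  have hd1 : d 1 = (Units.map (conjLocal L (IsCMField.complexConj L) v : LocalRing L v →* LocalRing L v) (d 0))⁻¹ := by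
    rw [eq_inv_iff_mul_eq_one]
    exact Units.ext (by rw [Units.val_mul, Units.coe_map, MonoidHom.coe_coe, Units.val_one, mul_comm]; exact hrel)
  -- `det M = (M₀₀ + M₀₁)(M₁₁ − M₀₁) = d 0 · d 1`
  have hdet2 : M.det = (M 0 0 + M 0 1) * (M 1 1 - M 0 1) := by
    rw [Matrix.det_fin_two]
    have h10 : M 1 0 = M 0 0 + M 0 1 - M 1 1 := by rw [hS]; ring
    rw [h10]; ring
  rw [hdet2, ← h00, ← h11, ← hdiag 0, ← hdiag 1, hu0, hd1]

set_option synthInstance.maxHeartbeats 400000 in -- the CM Borel telescope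
set_option maxHeartbeats 1600000 in
/-- **`μ_v(det p) = μ_v(a)²` on `P_Δ(L⁺_v)`**, `a = (det_Δ p_w)_w`: `det p = a (σa)⁻¹` (§3) and `μ_v(σ a) = μ_v(a)⁻¹` (§1).  The determinant is Mathlib's
`Matrix.GeneralLinearGroup.det` of the matrix of `p` over `E_v` (★ `localPiEquiv`).  This is why the twist `μ_v(det h)⁻¹` of the soft road kills the
`χ_v(det_Δ^{(2)})`-part `μ_v(a²)` of the parabolic eigen-scalar EXACTLY. [cite: Kudla1994, §3 Thm. 3.1] [cite: HarrisKudlaSweet1996, §1 (1.15)–(1.16)] -/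
theorem localMu_det_eq_localMu_sq (hχ : IsSplittingChar L 1 χ)
    {T₀ : Matrix (Fin 1) (Fin 1) ↥(maximalRealSubfield L)} (hT₀ : T₀.IsSymm) (hT₀d : IsUnit T₀.det)
    {JD : Matrix (Fin (1 + 1)) (Fin (1 + 1)) L}
    (hJD : JD = (gramD (↥(maximalRealSubfield L)) 1 T₀).map (algebraMap (↥(maximalRealSubfield L)) L))
    (P : Subgroup (UnitaryGroup.localPi L (IsCMField.complexConj L) (1 + 1) JD v))
    (hP : ∀ h, h ∈ P ↔ IsSiegelDelta (↥(maximalRealSubfield L)) L (IsCMField.complexConj L) (complexConj_imagUnit L)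
      (imagUnit_ne_zero L) (imagUnit_mul_self L) v 1 hT₀ hJD h)
    (p : ↥P) (u : (LocalRing L v)ˣ)
    (hu : ∀ w : PlacesOver L v, (u : LocalRing L v) w =
      detDelta (↥(maximalRealSubfield L)) L (IsCMField.complexConj L) v 1 w (p : UnitaryGroup.localPi L (IsCMField.complexConj L) (1 + 1) JD v)) :
    localMu L χ v (Matrix.GeneralLinearGroup.det
        ((localPiEquiv L (IsCMField.complexConj L) (1 + 1) JD v (p : UnitaryGroup.localPi L (IsCMField.complexConj L) (1 + 1) JD v)).1)) =
      localMu L χ v u ^ 2 := by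
  have hdet : Matrix.GeneralLinearGroup.det
      ((localPiEquiv L (IsCMField.complexConj L) (1 + 1) JD v (p : UnitaryGroup.localPi L (IsCMField.complexConj L) (1 + 1) JD v)).1) =
        u * (Units.map (conjLocal L (IsCMField.complexConj L) v : LocalRing L v →* LocalRing L v) u)⁻¹ :=
    Units.ext (by
      rw [Matrix.GeneralLinearGroup.val_det_apply, Units.val_mul]
      exact det_matS_eq_mul_conjLocal_inv L v hT₀ hT₀d hJD P hP p u hu)
  rw [hdet, map_mul, map_inv, localMu_conjLocal_eq_inv L χ v hχ u, inv_inv, sq]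

/-! ## §4 The scalar identity of the twisted section: `μ_v(det p)⁻¹ · χ_v(det_Δ^{(2)} q) · ∏_w ‖det_Δ^{(2)} q_w‖^{1∕2} = Δ_{P_Δ}(p)` -/

set_option synthInstance.maxHeartbeats 400000 in -- the CM Borel telescope
set_option maxHeartbeats 1600000 in
/-- **THE TWIST SCALAR IS THE MODULUS.**  For `p ∈ P_Δ(L⁺_v)` (doubled rank-ONE group, line `T₀`) and ANY element `q` of a doubled rank-`m` group `U(T ⊕ −T)(L⁺_v)`
whose `Δ`-determinants are the squares `det_Δ^{(m)} q_w = (det_Δ^{(1)} p_w)²` (the Kronecker image `q = ι p` for `m = 2`, ★-to-be `detDelta_kronLoc`):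
`μ_v(det p)⁻¹ · (∏_w χ_w⁻¹(det_Δ q_w))⁻¹ · ∏_w ‖det_Δ q_w‖^{1∕2} = Δ_{P_Δ}(p)` — as complex numbers, in the spelling of the eigen-law ★
`apply_zero_toRep_mul_localSplitting_eq_mul` (factor `((chiDet … (χ_w⁻¹) q)⁻¹ : ℂ) * ∏ w, √‖det_Δ q_w‖`) and of Mathlib's `modularCharacter` of `↥P` (★ ED. 2
`modularCharacter_siegelDelta_eq_unitModulusChar`: `Δ_{P_Δ}(p) = ‖a‖ = ∏_w ‖a_w‖`, ★ `coe_halfModulusChar_localRing_eq_prod`).  With §3 (`μ_v(det p) = μ_v(a)²`) the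
character parts cancel exactly. [cite: Kudla1994, §3 Thm. 3.1] [cite: HarrisKudlaSweet1996, §1 (1.15)–(1.16)] -/
theorem twistScalar_eq_modularCharacter (hχ : IsSplittingChar L 1 χ)
    {T₀ : Matrix (Fin 1) (Fin 1) ↥(maximalRealSubfield L)} (hT₀ : T₀.IsSymm) (hT₀d : IsUnit T₀.det)
    {JD : Matrix (Fin (1 + 1)) (Fin (1 + 1)) L}
    (hJD : JD = (gramD (↥(maximalRealSubfield L)) 1 T₀).map (algebraMap (↥(maximalRealSubfield L)) L))
    (P : Subgroup (UnitaryGroup.localPi L (IsCMField.complexConj L) (1 + 1) JD v))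
    (hP : ∀ h, h ∈ P ↔ IsSiegelDelta (↥(maximalRealSubfield L)) L (IsCMField.complexConj L) (complexConj_imagUnit L)
      (imagUnit_ne_zero L) (imagUnit_mul_self L) v 1 hT₀ hJD h)
    [LocallyCompactSpace ↥P] (p : ↥P)
    {m : ℕ} {JD₂ : Matrix (Fin (m + m)) (Fin (m + m)) L} (q : UnitaryGroup.localPi L (IsCMField.complexConj L) (m + m) JD₂ v)
    (hq : ∀ w : PlacesOver L v, detDelta (↥(maximalRealSubfield L)) L (IsCMField.complexConj L) v m w q =
      detDelta (↥(maximalRealSubfield L)) L (IsCMField.complexConj L) v 1 w (p : UnitaryGroup.localPi L (IsCMField.complexConj L) (1 + 1) JD v) ^ 2) :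
    (((localMu L χ v (Matrix.GeneralLinearGroup.det
          ((localPiEquiv L (IsCMField.complexConj L) (1 + 1) JD v (p : UnitaryGroup.localPi L (IsCMField.complexConj L) (1 + 1) JD v)).1)))⁻¹ :
          ℂˣ) : ℂ) *
        ((((chiDet (↥(maximalRealSubfield L)) L (IsCMField.complexConj L) v m (fun w => (χ.localComponent w.1)⁻¹) q)⁻¹ : ℂˣ) : ℂ) *
          ((∏ w : PlacesOver L v, Real.sqrt ‖detDelta (↥(maximalRealSubfield L)) L (IsCMField.complexConj L) v m w q‖ : ℝ) : ℂ)) =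
      (((modularCharacter p : ℝ≥0) : ℝ) : ℂ) := by
  -- the unit `a = (det_Δ p_w)_w` of `E_v`
  obtain ⟨u, hu⟩ : ∃ u : (LocalRing L v)ˣ, ∀ w : PlacesOver L v, (u : LocalRing L v) w =
      detDelta (↥(maximalRealSubfield L)) L (IsCMField.complexConj L) v 1 w (p : UnitaryGroup.localPi L (IsCMField.complexConj L) (1 + 1) JD v) :=
    ⟨(isUnit_detDelta_of_isSiegelDelta L v hT₀ hT₀d hJD P hP p).unit, fun w => by rw [IsUnit.unit_spec]⟩
  have hu2 : ∀ w : PlacesOver L v, ((u ^ 2 : (LocalRing L v)ˣ) : LocalRing L v) w =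
      detDelta (↥(maximalRealSubfield L)) L (IsCMField.complexConj L) v m w q := fun w => by
    rw [hq w, ← hu w, Units.val_pow_eq_pow_val, Pi.pow_apply]
  -- (1) the twist: `μ_v(det p) = μ_v(u)²`
  rw [localMu_det_eq_localMu_sq L χ v hχ hT₀ hT₀d hJD P hP p u hu]
  -- (2) the character part of the eigen-scalar: `(chiDet χ⁻¹ q)⁻¹ = μ_v(u²) = μ_v(u)²`
  rw [chiDet_localComponent_inv_eq L χ v q (u ^ 2) hu2, inv_inv, map_pow]
  -- (3) the modulus part: `∏_w √‖(u²)_w‖ = ‖u‖` and `Δ_{P_Δ}(p) = ‖u‖`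
  have hprod : ((∏ w : PlacesOver L v, Real.sqrt ‖detDelta (↥(maximalRealSubfield L)) L (IsCMField.complexConj L) v m w q‖ : ℝ) : ℂ) =
      (((unitModulusChar (LocalRing L v) u : ℝ≥0) : ℝ) : ℂ) := by
    have h1 : (∏ w : PlacesOver L v, Real.sqrt ‖detDelta (↥(maximalRealSubfield L)) L (IsCMField.complexConj L) v m w q‖) =
        ∏ w : PlacesOver L v, Real.sqrt ‖((u ^ 2 : (LocalRing L v)ˣ) : LocalRing L v) w‖ :=
      Finset.prod_congr rfl fun w _ => by rw [hu2 w]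
    rw [h1, ← coe_halfModulusChar_localRing_eq_prod, coe_halfModulusChar_apply, map_pow, NNReal.sqrt_eq_iff_eq_sq.2 rfl]
  rw [hprod, modularCharacter_siegelDelta_eq_unitModulusChar L v hT₀ hT₀d hJD P hP p u hu, ← mul_assoc, ← Units.val_mul,
    inv_mul_cancel, Units.val_one, one_mul]

end Siegel

end Literature.NumberTheory.GelbartRogawski1991.UnitaryDualPair.LocalSplitting

end
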